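import Mathlib
import Summits.Ventures.PercRepro2.Defs
import Summits.Ventures.PercRepro2.Independence
import Summits.Ventures.PercRepro2.Harris
import Summits.Ventures.PercRepro2.Graph
import Summits.Ventures.PercRepro2.Events
import Summits.Ventures.PercRepro2.Induced
import Summits.Ventures.PercRepro2.Frontier
import Summits.Ventures.PercRepro2.ObsIndependence
import Summits.Ventures.PercRepro2.BTVFamilyDefs
import Summits.Ventures.PercRepro2.BTVFamilyTower
import Summits.Ventures.PercRepro2.BlockConn
import Summits.Ventures.PercRepro2.BlockFamilyDefs
import Summits.Ventures.PercRepro2.BlockFamilyReveal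

/-!
# The block family: tower identities (blind cell PercRepro2, mine-1 g53;
paper proofs/MINE1-BLOCKS.md §2.3 (F3), (F2″))

The eight tower identities `P(cell on G[U]) = ∑_ω weight p ω · P(revealed cell on G[U ∖ z])`
(`BTVFamilyTower.prob_reveal` applied to the pointwise identities of `BlockFamilyReveal.lean`),
and the TOWER INEQUALITY of the glue: `∑_ω weight p ω · P(j on G[U ∖ z] with z replaced by its
open neighbours) ≤ P(j on G[U])` (`prob_reveal_ge` applied to `jEv_glue`).
-/

namespace Summit.Ventures.PercRepro2

namespace BlockFamily

open BTVFamily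

section Tower

variable {V : Type*} {E : Type*} [Fintype E] [DecidableEq E] [Fintype V] [DecidableEq V]
  {R : Type*} [CommRing R]

/-- **Tower inequality at a vertex**: if every `ω` in `Φ (frontier ω)` lies in `X`, then
`∑_ω weight p ω · P(Φ (frontier ω)) ≤ P(X)`. -/
theorem prob_reveal_ge [LinearOrder R] [IsStrictOrderedRing R] (p : E → R) (hp : IsProbVec p)
    (ends : E → Sym2 V) (U : Finset V) (z : V) {X : Set (Config E)} {Φ : Finset V → Set (Config E)}
    (hΦ : ∀ T, DependsOn (· ∈ Φ T) (within ends (↑(U \ {z}))))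
    (hX : ∀ ω, ω ∈ Φ (frontier ends U {z} ω) → ω ∈ X) :
    ∑ ω, weight p ω * prob p (Φ (frontier ends U {z} ω)) ≤ prob p X := by
  have e : expect p (fun ω => (Φ (frontier ends U {z} ω)).indicator (1 : Config E → R) ω) =
      ∑ ω, weight p ω * prob p (Φ (frontier ends U {z} ω)) := by
    rw [expect_tower p (F₁ := fun _ => touches ends (↑({z} : Finset V)))
      (F₂ := fun _ => within ends (↑(U \ {z}))) (S := frontier ends U {z})
      (Φ := fun T => (Φ T).indicator 1)
      (fun _ => disjoint_touches_within_sdiff ends U {z})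
      (fun T ω ω' h => by
        show (frontier ends U {z} ω = T) = (frontier ends U {z} ω' = T)
        rw [dependsOn_frontier ends U {z} h])
      fun T => dependsOn_indicator (hΦ T)]
    simp_rw [prob_eq_expect_indicator]
  rw [← e, prob_eq_expect_indicator]
  refine expect_mono hp fun ω => ?_
  by_cases h : ω ∈ Φ (frontier ends U {z} ω)
  · rw [Set.indicator_of_mem h, Set.indicator_of_mem (hX ω h)]
  · rw [Set.indicator_of_notMem h]
    exact Set.indicator_apply_nonneg fun _ => zero_le_one

variable (p : E → R) (ends : E → Sym2 V) {U : Finset V} {z : V} (hzU : z ∈ U) {s t : V}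
  (hzs : z ≠ s) (hzt : z ≠ t) {Vs : Finset V} (hzv : z ∉ Vs)
include hzU hzs hzt hzv

omit hzv in
/-- Tower identity for `a`, `z` a `u`-vertex. -/
lemma prob_aEv_reveal_A {A W : Finset V} (hzA : z ∈ A) (hzW : z ∉ W) :
    prob p (aEv ends U s t Vs A W) = ∑ ω, weight p ω *
      prob p (aEv ends (U \ {z}) s t Vs (A.erase z ∪ frontier ends U {z} ω) W) :=
  prob_reveal p ends U z (Φ := fun T => aEv ends (U \ {z}) s t Vs (A.erase z ∪ T) W)
    (fun T => dependsOn_induced_event ends (U \ {z}) (aProp ends s t Vs (A.erase z ∪ T) W))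
    (fun _ => aEv_reveal_A hzU hzs hzt hzA hzW)

omit hzv in
/-- Tower identity for `a`, `z` a `w`-vertex. -/
lemma prob_aEv_reveal_W {A W : Finset V} (hzA : z ∉ A) (hzW : z ∈ W) :
    prob p (aEv ends U s t Vs A W) = ∑ ω, weight p ω *
      prob p (aEv ends (U \ {z}) s t Vs A (W.erase z ∪ frontier ends U {z} ω)) :=
  prob_reveal p ends U z (Φ := fun T => aEv ends (U \ {z}) s t Vs A (W.erase z ∪ T))
    (fun T => dependsOn_induced_event ends (U \ {z}) (aProp ends s t Vs A (W.erase z ∪ T)))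
    (fun _ => aEv_reveal_W hzU hzs hzt hzA hzW)

omit hzv in
/-- Tower identity for `b`, `z` a block vertex. -/
lemma prob_bEv_reveal_A {𝒰 : Finset (Finset V)} {W : Finset V} (hzA : z ∈ unionB 𝒰)
    (hzW : z ∉ W) :
    prob p (bEv ends U s t Vs 𝒰 W) = ∑ ω, weight p ω *
      prob p (bEv ends (U \ {z}) s t Vs (revealBlocks 𝒰 z (frontier ends U {z} ω)) W) :=
  prob_reveal p ends U z (Φ := fun T => bEv ends (U \ {z}) s t Vs (revealBlocks 𝒰 z T) W)
    (fun T => dependsOn_induced_event ends (U \ {z}) (bProp ends s t Vs (revealBlocks 𝒰 z T) W))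
    (fun _ => bEv_reveal_A hzU hzs hzt hzA hzW)

omit hzv in
/-- Tower identity for `b`, `z` a `w`-vertex. -/
lemma prob_bEv_reveal_W {𝒰 : Finset (Finset V)} {W : Finset V} (hzA : z ∉ unionB 𝒰)
    (hzW : z ∈ W) :
    prob p (bEv ends U s t Vs 𝒰 W) = ∑ ω, weight p ω *
      prob p (bEv ends (U \ {z}) s t Vs 𝒰 (W.erase z ∪ frontier ends U {z} ω)) :=
  prob_reveal p ends U z (Φ := fun T => bEv ends (U \ {z}) s t Vs 𝒰 (W.erase z ∪ T))
    (fun T => dependsOn_induced_event ends (U \ {z}) (bProp ends s t Vs 𝒰 (W.erase z ∪ T)))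
    (fun _ => bEv_reveal_W hzU hzs hzt hzA hzW)

/-- Tower identity for `j`, `z` a block vertex. -/
lemma prob_jEv_reveal_A {A : Finset V} {𝒰 : Finset (Finset V)} {W : Finset V} (hzA : z ∈ A)
    (hzB : z ∈ unionB 𝒰) (hzW : z ∉ W) :
    prob p (jEv ends U s t Vs A 𝒰 W) = ∑ ω, weight p ω *
      prob p (jEv ends (U \ {z}) s t Vs (A.erase z ∪ frontier ends U {z} ω)
        (revealBlocks 𝒰 z (frontier ends U {z} ω)) W) :=
  prob_reveal p ends U z
    (Φ := fun T => jEv ends (U \ {z}) s t Vs (A.erase z ∪ T) (revealBlocks 𝒰 z T) W)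
    (fun T => dependsOn_induced_event ends (U \ {z})
      (jProp ends s t Vs (A.erase z ∪ T) (revealBlocks 𝒰 z T) W))
    (fun _ => jEv_reveal_A hzU hzs hzt hzv hzA hzB hzW)

omit hzv in
/-- Tower identity for `j`, `z` a `w`-vertex. -/
lemma prob_jEv_reveal_W {A : Finset V} {𝒰 : Finset (Finset V)} (h𝒰 : unionB 𝒰 ⊆ A)
    {W : Finset V} (hzA : z ∉ A) (hzW : z ∈ W) :
    prob p (jEv ends U s t Vs A 𝒰 W) = ∑ ω, weight p ω *
      prob p (jEv ends (U \ {z}) s t Vs A 𝒰 (W.erase z ∪ frontier ends U {z} ω)) :=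
  prob_reveal p ends U z (Φ := fun T => jEv ends (U \ {z}) s t Vs A 𝒰 (W.erase z ∪ T))
    (fun T => dependsOn_induced_event ends (U \ {z}) (jProp ends s t Vs A 𝒰 (W.erase z ∪ T)))
    (fun _ => jEv_reveal_W hzU hzs hzt h𝒰 hzA hzW)

omit hzv in
/-- Tower identity for `m`, `z` a `u`-vertex. -/
lemma prob_mEv_reveal_A {A W : Finset V} (hzA : z ∈ A) (hzW : z ∉ W) :
    prob p (mEv ends U s t Vs A W) = ∑ ω, weight p ω *
      prob p (mEv ends (U \ {z}) s t Vs (A.erase z ∪ frontier ends U {z} ω) W) :=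
  prob_reveal p ends U z (Φ := fun T => mEv ends (U \ {z}) s t Vs (A.erase z ∪ T) W)
    (fun T => dependsOn_induced_event ends (U \ {z}) (mProp ends s t Vs (A.erase z ∪ T) W))
    (fun _ => mEv_reveal_A hzU hzs hzt hzA hzW)

/-- Tower identity for `m`, `z` a `w`-vertex. -/
lemma prob_mEv_reveal_W {A W : Finset V} (hzA : z ∉ A) (hzW : z ∈ W) :
    prob p (mEv ends U s t Vs A W) = ∑ ω, weight p ω *
      prob p (mEv ends (U \ {z}) s t Vs A (W.erase z ∪ frontier ends U {z} ω)) :=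
  prob_reveal p ends U z (Φ := fun T => mEv ends (U \ {z}) s t Vs A (W.erase z ∪ T))
    (fun T => dependsOn_induced_event ends (U \ {z}) (mProp ends s t Vs A (W.erase z ∪ T)))
    (fun _ => mEv_reveal_W hzU hzs hzt hzv hzA hzW)

omit hzv in
/-- **The glue, summed**: `∑_ω weight p ω · P(j on G[U ∖ z] with z replaced by its open neighbours)
≤ P(j on G[U])` for `z ∈ U`, `z ≠ s, t`, `z ∉ W`. -/
lemma prob_jEv_glue_le [LinearOrder R] [IsStrictOrderedRing R] (hp : IsProbVec p) (A : Finset V)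
    (𝒰 : Finset (Finset V)) {W : Finset V} (hzW : z ∉ W) :
    ∑ ω, weight p ω * prob p (jEv ends (U \ {z}) s t Vs (A.erase z ∪ frontier ends U {z} ω) 𝒰 W) ≤
      prob p (jEv ends U s t Vs A 𝒰 W) :=
  prob_reveal_ge p hp ends U z (Φ := fun T => jEv ends (U \ {z}) s t Vs (A.erase z ∪ T) 𝒰 W)
    (fun T => dependsOn_induced_event ends (U \ {z}) (jProp ends s t Vs (A.erase z ∪ T) 𝒰 W))
    (fun _ h => jEv_glue hzU hzs hzt 𝒰 hzW h)

end Tower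

end BlockFamily

end Summit.Ventures.PercRepro2
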